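import Mathlib
import HarnessLib
import Literature.Analysis.FluidPDE.PineauVicolAngularMean
import Literature.Analysis.FluidPDE.SpaceTimeParametricIntegral
import Literature.Analysis.FluidPDE.SpaceTimeCalculus
import Literature.Analysis.FluidPDE.ClassicalSolutionCalculus
import Summits.NavierStokesRegularity.NavierStokesRegularity.Theorems.AxisTwistDoorAveragedConeLiouvilleCircleSwirl
import Summits.NavierStokesRegularity.NavierStokesRegularity.Theorems.AxisTwistDoorAveragedConeLiouvilleCircleToolkit
import Summits.NavierStokesRegularity.NavierStokesRegularity.Theorems.AxisTwistDoorAveragedConeLiouvilleCylFrame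
import Summits.NavierStokesRegularity.NavierStokesRegularity.Theorems.AxisTwistDoorAveragedConeLiouvilleCircMonotone
import Summits.NavierStokesRegularity.NavierStokesRegularity.Theorems.AxisTwistDoorAveragedConeLiouvilleAxisLift
import Summits.NavierStokesRegularity.NavierStokesRegularity.Theorems.PoloidalWindowDoorPoloidalWindowRigidityWindow

/-!
# Route `HalfSpaceWindowDoor`, crux `CirculationCarryingRigidity` (stmt-NavierStokesRegularity-25311) — the AXIS CIRCULATION
# of a door-class profile as a smooth axisymmetric scalar on `ℝ³` (kinematics for the sourced swirl Liouville tool)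

For a profile `v` of the door's Type-I ancient Oseen-mild class, the axis circulation `Γ(r,z,s) = ∮_{S(r,z)} v(s)·e_θ dl`
(AxisTwistDoor's `circ`, route-independent vocabulary `…AxisTwistDoorAveragedConeLiouvilleDefs`) lifted to `ℝ³`,
`F(s, x) = (2π)⁻¹ Γ(|x_h|, x₃, s)`, IS the angular mean of the swirl `x₀v₁ − x₁v₀` (Pineau–Vicol `angularMean`, tree):
`F(s,·) = ⟨swirl (v s)⟩_θ` (`circF_eq_angularMean`).  Consequences: `F(s,·)` is smooth on all of `ℝ³` (axis included) and
jointly smooth on the open slab (`isSmoothSpaceTimeOn_circF`), axisymmetric, zero on the axis, `|F| ≤ D` under the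
space–time Type-I bound `‖v(t,x)‖ ≤ D/(‖x‖ + √(−t))`, and its radial derivative is `(2π)⁻¹ ∮ω₃ dl ≥ 0` under the
closed-hemisphere sign (`fderiv_circF_eR`, Stokes on circles = tree `deriv_circ_eq_vortCirc`); off the axis its Laplacian
and time derivative are those of the lift (`…AxisLift.laplacian_lift`, `…CircleSwirl.hasDerivAt_circ_s`).

Seat ns-hsw-p1 g3 (LEAD of 25311, cell pub-ns-dss).  WHAT THIS IS NOT: not a statement about Navier–Stokes regularity;
kinematics of HYPOTHETICAL blow-up profiles; helper `--supports` 25311.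
-/

noncomputable section

-- the summit and its single sub-problem share the name (CONVENTIONS §1), as in every Theorems file
set_option linter.dupNamespace false

namespace Summit.NavierStokesRegularity.NavierStokesRegularity.Theorems.HalfSpaceWindowDoorCirculationCarryingRigidityAxisCirculation

open MeasureTheory Set Function Filter Topology TopologicalSpace InnerProductSpace WithLp Metric
open scoped Laplacian RealInnerProductSpace ContDiff
open Literature.Analysis Literature.Analysis.FluidPDE
open Summit.NavierStokesRegularity.NavierStokesRegularity.Theorems.AxisTwistDoorAveragedConeLiouvilleDefs
  (cylPt eT e3 circ vortCirc radVortCirc tiltCirc meanR meanZ remainder CircleSwirlEquation SignE3 GlobalCone)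
open Summit.NavierStokesRegularity.NavierStokesRegularity.Theorems.AveragedConeLiouville.CircleStokes
  (deriv_circ_eq_vortCirc hasDerivAt_circ)
open Summit.NavierStokesRegularity.NavierStokesRegularity.Theorems.AveragedConeLiouville.CircMonotone
  (circ_zero vortCirc_zero vortCirc_nonneg)
open Summit.NavierStokesRegularity.NavierStokesRegularity.Theorems.AxisTwistDoorAveragedConeLiouvilleAxisLift
  (lift laplacian_lift gradient_lift contDiffAt_lift)
open Summit.NavierStokesRegularity.NavierStokesRegularity.Theorems.AxisTwistDoorAveragedConeLiouvilleCylFrame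
  (contDiff_cylPt_comp contDiff_eT_comp)
open Summit.NavierStokesRegularity.NavierStokesRegularity.Theorems.AxisTwistDoorAveragedConeLiouvilleCircleToolkit (abs_circ_le)
open Summit.NavierStokesRegularity.NavierStokesRegularity.Theorems.PoloidalWindowDoorPoloidalWindowRigidityWindow
  (isTypeIAncientMild_of_class)

variable {C D : ℝ} {v : ℝ → EuclideanSpace ℝ (Fin 3) → EuclideanSpace ℝ (Fin 3)}

/-! ### Polar representation and the swirl on axis circles -/

/-- Rotating the circle point: `R_φ (cylPt r θ z) = cylPt r (θ + φ) z`. -/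
theorem rotZ_cylPt (φ r θ z : ℝ) : rotZ φ (cylPt r θ z) = cylPt r (θ + φ) z := by
  ext i
  fin_cases i
  · simp [rotZ, cylPt, Real.cos_add]; ring
  · simp [rotZ, cylPt, Real.sin_add]; ring
  · simp [rotZ, cylPt]

/-- Every point is a rotation of the meridian point `cylPt r 0 z`, `r = |x_h|`, `z = x₂`. -/
theorem exists_rotZ_cylPt_eq (y : EuclideanSpace ℝ (Fin 3)) :
    ∃ θ₀ : ℝ, rotZ θ₀ (cylPt (cylRadius y) 0 (y 2)) = y := by
  refine ⟨Complex.arg ⟨y 0, y 1⟩, ?_⟩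
  have h : cylPt (cylRadius y) 0 (y 2) = meridianPoint (meridian y) := by
    ext i
    fin_cases i <;> simp [cylPt, meridianPoint]
  rw [h]
  exact rotZ_arg_meridianPoint y

/-- The swirl on an axis circle: `(x₀u₁ − x₁u₀)(cylPt r θ z) = ⟪u, e_θ⟫ r`. -/
theorem swirl_cylPt (u : EuclideanSpace ℝ (Fin 3) → EuclideanSpace ℝ (Fin 3)) (r θ z : ℝ) :
    swirl u (cylPt r θ z) = ⟪u (cylPt r θ z), eT θ⟫_ℝ * r := by
  rw [swirl]
  have h0 : cylPt r θ z 0 = r * Real.cos θ := by simp [cylPt]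
  have h1 : cylPt r θ z 1 = r * Real.sin θ := by simp [cylPt]
  rw [h0, h1]
  have hi : ⟪u (cylPt r θ z), eT θ⟫_ℝ = -Real.sin θ * u (cylPt r θ z) 0 + Real.cos θ * u (cylPt r θ z) 1 := by
    simp [eT, EuclideanSpace.inner_eq_star_dotProduct, Fin.sum_univ_three, dotProduct]
    try ring
  rw [hi]
  ring

/-- The circulation integrand is `2π`-periodic in the angle. -/
theorem periodic_circ_integrand (u : EuclideanSpace ℝ (Fin 3) → EuclideanSpace ℝ (Fin 3)) (r z : ℝ) :
    Function.Periodic (fun θ => ⟪u (cylPt r θ z), eT θ⟫_ℝ * r) (2 * Real.pi) := by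
  intro θ
  have h1 : cylPt r (θ + 2 * Real.pi) z = cylPt r θ z := by
    ext i; fin_cases i <;> simp [cylPt]
  have h2 : eT (θ + 2 * Real.pi) = eT θ := by
    ext i; fin_cases i <;> simp [eT]
  simp only [h1, h2]

/-- **The angular mean of the swirl is the normalised axis circulation**: for any slice `u`,
`⟨swirl u⟩_θ(y) = (2π)⁻¹ ∮_{S(|y_h|, y₂)} ⟪u, e_θ⟫ dl`. -/
theorem angularMean_swirl (u : EuclideanSpace ℝ (Fin 3) → EuclideanSpace ℝ (Fin 3)) (y : EuclideanSpace ℝ (Fin 3)) :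
    angularMean (swirl u) y =
      (2 * Real.pi)⁻¹ * ∫ θ in (0 : ℝ)..(2 * Real.pi), ⟪u (cylPt (cylRadius y) θ (y 2)), eT θ⟫_ℝ * cylRadius y := by
  obtain ⟨θ₀, hy⟩ := exists_rotZ_cylPt_eq y
  rw [angularMean_apply, smul_eq_mul]
  congr 1
  have hint : (fun θ => swirl u (rotZ θ y)) =
      fun θ => (fun φ => ⟪u (cylPt (cylRadius y) φ (y 2)), eT φ⟫_ℝ * cylRadius y) (θ + θ₀) := by
    funext θ
    conv_lhs => rw [← hy]
    rw [← rotZ_add, rotZ_cylPt, swirl_cylPt]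
    simp only [zero_add]
  rw [hint, intervalIntegral.integral_comp_add_right (fun φ => ⟪u (cylPt (cylRadius y) φ (y 2)), eT φ⟫_ℝ * cylRadius y)]
  have hp := periodic_circ_integrand u (cylRadius y) (y 2)
  have := hp.intervalIntegral_add_eq θ₀ 0
  simp only [zero_add] at this
  rw [show 0 + θ₀ = θ₀ by ring, show 2 * Real.pi + θ₀ = θ₀ + 2 * Real.pi by ring, this]

/-- For a time-dependent field: `⟨swirl (v s)⟩_θ(x) = (2π)⁻¹ Γ(|x_h|, x₂, s)`. -/
theorem angularMean_swirl_eq_circ (v : ℝ → EuclideanSpace ℝ (Fin 3) → EuclideanSpace ℝ (Fin 3)) (s : ℝ)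
    (x : EuclideanSpace ℝ (Fin 3)) :
    angularMean (swirl (v s)) x = (2 * Real.pi)⁻¹ * circ v (cylRadius x) (x 2) s := by
  rw [angularMean_swirl]; rfl

/-- The lifted circulation as a function: `(2π)⁻¹ Γ(|x_h|, x₂, s) = ⟨swirl (v s)⟩_θ`. -/
theorem circF_eq_angularMean (v : ℝ → EuclideanSpace ℝ (Fin 3) → EuclideanSpace ℝ (Fin 3)) (s : ℝ) :
    (fun x : EuclideanSpace ℝ (Fin 3) => (2 * Real.pi)⁻¹ * circ v (cylRadius x) (x 2) s) = angularMean (swirl (v s)) :=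
  funext fun x => (angularMean_swirl_eq_circ v s x).symm

/-! ### Smoothness -/

/-- The swirl of a `Cⁿ` field is `Cⁿ`. -/
theorem contDiff_swirl' {u : EuclideanSpace ℝ (Fin 3) → EuclideanSpace ℝ (Fin 3)} {n : WithTop ℕ∞}
    (hu : ContDiff ℝ n u) : ContDiff ℝ n (swirl u) := by
  have h0 : ContDiff ℝ n fun x : EuclideanSpace ℝ (Fin 3) => x 0 :=
    contDiff_piLp_apply (𝕜 := ℝ) (p := 2) (E := fun _ : Fin 3 => ℝ) (i := 0)
  have h1 : ContDiff ℝ n fun x : EuclideanSpace ℝ (Fin 3) => x 1 :=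
    contDiff_piLp_apply (𝕜 := ℝ) (p := 2) (E := fun _ : Fin 3 => ℝ) (i := 1)
  have hu0 : ContDiff ℝ n fun x => u x 0 := h0.comp hu
  have hu1 : ContDiff ℝ n fun x => u x 1 := h1.comp hu
  exact (h0.mul hu1).sub (h1.mul hu0)

/-- **The lifted circulation of a smooth slice is smooth on all of `ℝ³`** (axis included): it is the angular mean of
the swirl. -/
theorem contDiff_circF {s : ℝ} {n : ℕ∞} (hv : ContDiff ℝ n (v s)) :
    ContDiff ℝ n (fun x : EuclideanSpace ℝ (Fin 3) => (2 * Real.pi)⁻¹ * circ v (cylRadius x) (x 2) s) := by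
  have h := contDiff_angularMean (F := ℝ) (contDiff_swirl' hv)
  rw [circF_eq_angularMean]
  exact h

/-- **Joint smoothness of the lifted circulation on the open slab** for a field jointly smooth there (differentiation
under `∫₀^{2π}` of the jointly smooth integrand `swirl (v s) (R_θ x)`; tree `contDiffOn_parametric_intervalIntegral_prod`). -/
theorem isSmoothSpaceTimeOn_circF (hv : IsSmoothSpaceTimeOn (Iio (0 : ℝ)) v) :
    IsSmoothSpaceTimeOn (Iio (0 : ℝ))
      (fun s (x : EuclideanSpace ℝ (Fin 3)) => (2 * Real.pi)⁻¹ * circ v (cylRadius x) (x 2) s) := by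
  -- the integrand `H (θ, (s, x)) = swirl (v s) (R_θ x)` is smooth on `univ × (slab)`
  set H : ℝ × (ℝ × EuclideanSpace ℝ (Fin 3)) → ℝ := fun w => swirl (v w.2.1) (rotZ w.1 w.2.2) with hH
  have hrot : ContDiff ℝ ∞ fun w : ℝ × (ℝ × EuclideanSpace ℝ (Fin 3)) => rotZ w.1 w.2.2 :=
    contDiff_rotZ_uncurry.comp₂ contDiff_fst (contDiff_snd.comp contDiff_snd)
  have h21 : ContDiff ℝ ∞ fun w : ℝ × (ℝ × EuclideanSpace ℝ (Fin 3)) => w.2.1 := contDiff_fst.comp contDiff_snd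
  have hg : ContDiff ℝ ∞ fun w : ℝ × (ℝ × EuclideanSpace ℝ (Fin 3)) =>
      ((w.2.1, rotZ w.1 w.2.2) : ℝ × EuclideanSpace ℝ (Fin 3)) := h21.prodMk hrot
  have hmaps : MapsTo (fun w : ℝ × (ℝ × EuclideanSpace ℝ (Fin 3)) =>
      ((w.2.1, rotZ w.1 w.2.2) : ℝ × EuclideanSpace ℝ (Fin 3))) (univ ×ˢ (Iio (0 : ℝ) ×ˢ univ))
      (Iio (0 : ℝ) ×ˢ univ) := by
    intro w hw
    simp only [mem_prod, mem_univ, mem_Iio, true_and, and_true] at hw ⊢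
    exact hw
  have hvw : ContDiffOn ℝ ∞ (fun w : ℝ × (ℝ × EuclideanSpace ℝ (Fin 3)) => v w.2.1 (rotZ w.1 w.2.2))
      (univ ×ˢ (Iio (0 : ℝ) ×ˢ univ)) := hv.comp hg.contDiffOn hmaps
  have hHs : ContDiffOn ℝ ∞ H (univ ×ˢ (Iio (0 : ℝ) ×ˢ univ)) := by
    have c0 : ContDiff ℝ ∞ fun x : EuclideanSpace ℝ (Fin 3) => x 0 :=
      contDiff_piLp_apply (𝕜 := ℝ) (p := 2) (E := fun _ : Fin 3 => ℝ) (i := 0)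
    have c1 : ContDiff ℝ ∞ fun x : EuclideanSpace ℝ (Fin 3) => x 1 :=
      contDiff_piLp_apply (𝕜 := ℝ) (p := 2) (E := fun _ : Fin 3 => ℝ) (i := 1)
    have p0 : ContDiff ℝ ∞ fun w : ℝ × (ℝ × EuclideanSpace ℝ (Fin 3)) => rotZ w.1 w.2.2 0 := c0.comp hrot
    have p1 : ContDiff ℝ ∞ fun w : ℝ × (ℝ × EuclideanSpace ℝ (Fin 3)) => rotZ w.1 w.2.2 1 := c1.comp hrot
    have q0 : ContDiffOn ℝ ∞ (fun w : ℝ × (ℝ × EuclideanSpace ℝ (Fin 3)) => v w.2.1 (rotZ w.1 w.2.2) 0)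
        (univ ×ˢ (Iio (0 : ℝ) ×ˢ univ)) := c0.comp_contDiffOn hvw
    have q1 : ContDiffOn ℝ ∞ (fun w : ℝ × (ℝ × EuclideanSpace ℝ (Fin 3)) => v w.2.1 (rotZ w.1 w.2.2) 1)
        (univ ×ˢ (Iio (0 : ℝ) ×ˢ univ)) := c1.comp_contDiffOn hvw
    exact (p0.contDiffOn.mul q1).sub (p1.contDiffOn.mul q0)
  have hI := contDiffOn_parametric_intervalIntegral_prod (convex_Iio (0 : ℝ))
    (by rw [interior_Iio]; exact ⟨-1, by norm_num⟩) hHs 0 (2 * Real.pi)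
  have hI' := hI.const_smul ((2 * Real.pi)⁻¹ : ℝ)
  refine hI'.congr fun p _ => ?_
  show (2 * Real.pi)⁻¹ * circ v (cylRadius p.2) (p.2 2) p.1 = (2 * Real.pi)⁻¹ • ∫ θ in (0:ℝ)..(2 * Real.pi), H (θ, p)
  rw [← angularMean_swirl_eq_circ, angularMean_apply]

/-- A door-class profile is jointly smooth on the open slab. -/
theorem isSmoothSpaceTimeOn_of_class (hrate : HasTypeITimeDecay C v)
    (hcont : ContinuousOn (uncurry v) (Iio (0 : ℝ) ×ˢ univ))
    (hmild : ∀ s t : ℝ, s < t → t < 0 → ∀ x,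
      v t x = UnboundedOperators.heatExtension (v s) (t - s) x - oseenDuhamel 1 s v v t x)
    (hdiv : ∀ t < 0, VectorCalculus.IsDivFree (v t)) : IsSmoothSpaceTimeOn (Iio (0 : ℝ)) v :=
  (isTypeIAncientMild_of_class hrate hcont hmild hdiv).contDiffOn

/-! ### Axis, symmetry, size -/

/-- `r ≤ ‖cylPt r θ z‖` for `r ≥ 0`. -/
theorem le_norm_cylPt {r : ℝ} (hr : 0 ≤ r) (θ z : ℝ) : r ≤ ‖cylPt r θ z‖ := by
  have h : r ^ 2 ≤ ‖cylPt r θ z‖ ^ 2 := by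
    rw [EuclideanSpace.real_norm_sq_eq, Fin.sum_univ_three]
    simp only [cylPt, PiLp.toLp_apply, Matrix.cons_val_zero, Matrix.cons_val_one, Matrix.cons_val]
    nlinarith [sq_nonneg z, Real.cos_sq_add_sin_sq θ, sq_nonneg (r * Real.cos θ), sq_nonneg (r * Real.sin θ)]
  exact (pow_le_pow_iff_left₀ hr (norm_nonneg _) two_ne_zero).1 h

/-- The space–time Type-I constant is non-negative. -/
theorem typeIDecay_nonneg (hD : HasTypeIDecay D v) {s : ℝ} (hs : s < 0) : 0 ≤ D := by
  have h := hD s hs 0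
  have hpos : 0 < ‖(0 : EuclideanSpace ℝ (Fin 3))‖ + Real.sqrt (-s) := by
    rw [norm_zero, zero_add]; exact Real.sqrt_pos.2 (by linarith)
  have h0 : 0 ≤ D / (‖(0 : EuclideanSpace ℝ (Fin 3))‖ + Real.sqrt (-s)) := (norm_nonneg _).trans h
  by_contra hneg
  have : D / (‖(0 : EuclideanSpace ℝ (Fin 3))‖ + Real.sqrt (-s)) < 0 := div_neg_of_neg_of_pos (lt_of_not_ge hneg) hpos
  linarith

/-- **The velocity on an axis circle under the space–time Type-I bound**: `‖v(s)(cylPt r θ z)‖ ≤ D/(r + √(−s))`. -/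
theorem norm_le_on_circle (hD : HasTypeIDecay D v) {s : ℝ} (hs : s < 0) {r : ℝ} (hr : 0 ≤ r) (θ z : ℝ) :
    ‖v s (cylPt r θ z)‖ ≤ D / (r + Real.sqrt (-s)) := by
  have hD0 : 0 ≤ D := typeIDecay_nonneg hD hs
  have h := hD s hs (cylPt r θ z)
  have hsq : 0 < Real.sqrt (-s) := Real.sqrt_pos.2 (by linarith)
  refine h.trans (div_le_div_of_nonneg_left hD0 (by positivity) ?_)
  linarith [le_norm_cylPt hr θ z]

/-- **`|F| ≤ D`**: the lifted normalised circulation of a space–time Type-I profile is bounded by the Type-I constant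
(`|Γ(r,z,s)| ≤ 2πr · D/(r + √(−s)) ≤ 2πD`). -/
theorem abs_circF_le (hD : HasTypeIDecay D v) {s : ℝ} (hs : s < 0) (x : EuclideanSpace ℝ (Fin 3)) :
    |(2 * Real.pi)⁻¹ * circ v (cylRadius x) (x 2) s| ≤ D := by
  have hD0 : 0 ≤ D := typeIDecay_nonneg hD hs
  by_cases hr0 : cylRadius x = 0
  · rw [hr0, circ_zero]; simp [hD0]
  have hr : 0 < cylRadius x := lt_of_le_of_ne (cylRadius_nonneg x) (Ne.symm hr0)
  have hsq : 0 < Real.sqrt (-s) := Real.sqrt_pos.2 (by linarith)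
  have hB : ∀ θ : ℝ, ‖v s (cylPt (cylRadius x) θ (x 2))‖ ≤ D / (cylRadius x + Real.sqrt (-s)) :=
    fun θ => norm_le_on_circle hD hs hr.le θ (x 2)
  have h := abs_circ_le hr hB
  have hπ : 0 < 2 * Real.pi := by positivity
  rw [abs_mul, abs_of_pos (inv_pos.2 hπ), inv_mul_le_iff₀ hπ]
  refine h.trans ?_
  have key : cylRadius x * (D / (cylRadius x + Real.sqrt (-s))) ≤ D := by
    rw [mul_div_assoc', div_le_iff₀ (by positivity)]
    nlinarith
  nlinarith

/-- `F(s,·)` vanishes on the axis. -/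
theorem circF_axis (v : ℝ → EuclideanSpace ℝ (Fin 3) → EuclideanSpace ℝ (Fin 3)) (s : ℝ) {x : EuclideanSpace ℝ (Fin 3)}
    (hx : cylRadius x = 0) : (2 * Real.pi)⁻¹ * circ v (cylRadius x) (x 2) s = 0 := by
  rw [hx, circ_zero, mul_zero]

/-- `F(s,·)` is an axisymmetric scalar. -/
theorem isAxisymmetricScalar_circF (v : ℝ → EuclideanSpace ℝ (Fin 3) → EuclideanSpace ℝ (Fin 3)) (s : ℝ) :
    IsAxisymmetricScalar fun x : EuclideanSpace ℝ (Fin 3) => (2 * Real.pi)⁻¹ * circ v (cylRadius x) (x 2) s := by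
  intro θ x
  simp only [cylRadius_rotZ, rotZ_apply_two]

/-! ### Derivatives off the axis: the lift calculus of `…AxisLift` -/

/-- The joint smoothness datum of `…AxisLift` for `Γ = circ v`: `(r,z,s) ↦ Γ(r,z,s)` is `C²` on `s < 0` (the tree's
`…CircleToolkit.contDiffOn_circ`, re-proved for the door class: it only uses joint smoothness of `v`). -/
theorem contDiffOn_circ (hv : IsSmoothSpaceTimeOn (Iio (0 : ℝ)) v) :
    ContDiffOn ℝ 2 (fun q : ℝ × ℝ × ℝ => circ v q.1 q.2.1 q.2.2) {q | q.2.2 < 0} := by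
  have hg : ContDiff ℝ ∞ fun w : ℝ × (ℝ × (ℝ × ℝ)) => ((w.2.1, cylPt w.2.2.1 w.1 w.2.2.2) :
      ℝ × EuclideanSpace ℝ (Fin 3)) :=
    (contDiff_fst.comp contDiff_snd).prodMk
      (contDiff_cylPt_comp (contDiff_fst.comp (contDiff_snd.comp contDiff_snd)) contDiff_fst
        (contDiff_snd.comp (contDiff_snd.comp contDiff_snd)))
  have hmaps : MapsTo (fun w : ℝ × (ℝ × (ℝ × ℝ)) => ((w.2.1, cylPt w.2.2.1 w.1 w.2.2.2) :
      ℝ × EuclideanSpace ℝ (Fin 3))) (univ ×ˢ (Iio (0 : ℝ) ×ˢ univ)) (Iio (0 : ℝ) ×ˢ univ) := by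
    intro w hw
    simp only [mem_prod, mem_univ, mem_Iio, true_and, and_true] at hw ⊢
    exact hw
  have hvc : ContDiffOn ℝ ∞ (fun w : ℝ × (ℝ × (ℝ × ℝ)) => v w.2.1 (cylPt w.2.2.1 w.1 w.2.2.2))
      (univ ×ˢ (Iio (0 : ℝ) ×ˢ univ)) := hv.comp hg.contDiffOn hmaps
  have hint : ContDiffOn ℝ ∞ (fun w : ℝ × (ℝ × (ℝ × ℝ)) => ⟪v w.2.1 (cylPt w.2.2.1 w.1 w.2.2.2), eT w.1⟫_ℝ * w.2.2.1)
      (univ ×ˢ (Iio (0 : ℝ) ×ˢ univ)) :=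
    (hvc.inner ℝ (contDiff_eT_comp contDiff_fst).contDiffOn).mul (contDiff_fst.comp (contDiff_snd.comp contDiff_snd)).contDiffOn
  have hI : ContDiffOn ℝ ∞ (fun p : ℝ × (ℝ × ℝ) => ∫ θ in (0 : ℝ)..(2 * Real.pi),
      (fun w : ℝ × (ℝ × (ℝ × ℝ)) => ⟪v w.2.1 (cylPt w.2.2.1 w.1 w.2.2.2), eT w.1⟫_ℝ * w.2.2.1) (θ, p))
      (Iio (0 : ℝ) ×ˢ (univ : Set (ℝ × ℝ))) :=
    contDiffOn_parametric_intervalIntegral_prod (convex_Iio 0)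
      (by rw [interior_Iio]; exact ⟨-1, by norm_num⟩) hint _ _
  have hσ : ContDiff ℝ ∞ fun q : ℝ × ℝ × ℝ => ((q.2.2, (q.1, q.2.1)) : ℝ × (ℝ × ℝ)) :=
    (contDiff_snd.comp contDiff_snd).prodMk (contDiff_fst.prodMk (contDiff_fst.comp contDiff_snd))
  have hmaps' : MapsTo (fun q : ℝ × ℝ × ℝ => ((q.2.2, (q.1, q.2.1)) : ℝ × (ℝ × ℝ))) {q | q.2.2 < 0}
      (Iio (0 : ℝ) ×ˢ (univ : Set (ℝ × ℝ))) := fun q hq => mem_prod.2 ⟨hq, mem_univ _⟩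
  have h2 : ((2 : ℕ) : WithTop ℕ∞) ≤ ∞ := WithTop.coe_le_coe.2 le_top
  exact ((hI.comp hσ.contDiffOn hmaps').of_le h2).congr fun q _ => rfl

/-- **The radial derivative of `F` is the normalised vertical-vorticity flux through the circle**:
`DF(s,·)(x)[e_r x] = (2π)⁻¹ ∮_{S(|x_h|,x₂)} ω₃ dl` (Stokes on circles; on the axis both sides vanish). -/
theorem fderiv_circF_eR (hv : IsSmoothSpaceTimeOn (Iio (0 : ℝ)) v) {s : ℝ} (hs : s < 0) (x : EuclideanSpace ℝ (Fin 3)) :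
    fderiv ℝ (fun y : EuclideanSpace ℝ (Fin 3) => (2 * Real.pi)⁻¹ * circ v (cylRadius y) (y 2) s) x (eR x) =
      (2 * Real.pi)⁻¹ * vortCirc v (cylRadius x) (x 2) s := by
  by_cases hx : cylRadius x = 0
  · have h0 : eR x = 0 := by simp [eR, hx]
    rw [h0, map_zero, hx, vortCirc_zero, mul_zero]
  have hΓ := contDiffOn_circ hv
  have hv1 : ContDiff ℝ 1 (v s) := (hv.contDiff_slice hs).of_le (by norm_cast)
  -- `F(s,·) = (2π)⁻¹ • lift Γ s`
  have hfun : (fun y : EuclideanSpace ℝ (Fin 3) => (2 * Real.pi)⁻¹ * circ v (cylRadius y) (y 2) s) =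
      fun y => (2 * Real.pi)⁻¹ * lift (circ v) s y := rfl
  have hd : DifferentiableAt ℝ (lift (circ v) s) x :=
    (contDiffAt_lift hΓ hs hx).differentiableAt (by norm_num)
  rw [hfun, fderiv_const_mul hd, _root_.smul_apply, smul_eq_mul]
  congr 1
  have hgrad := gradient_lift hΓ hs hx
  have hinner : fderiv ℝ (lift (circ v) s) x (eR x) = ⟪gradient (lift (circ v) s) x, eR x⟫_ℝ := by
    rw [gradient, InnerProductSpace.toDual_symm_apply]
  rw [hinner, hgrad, inner_add_left, real_inner_smul_left, real_inner_smul_left, inner_eR_self hx,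
    real_inner_comm, inner_eR_eZ, mul_one, mul_zero, add_zero, deriv_circ_eq_vortCirc v hv1]

/-- Under the closed-hemisphere sign the radial derivative of `F` is non-negative. -/
theorem fderiv_circF_eR_nonneg (hv : IsSmoothSpaceTimeOn (Iio (0 : ℝ)) v) (hsign : SignE3 v) {s : ℝ} (hs : s < 0)
    (x : EuclideanSpace ℝ (Fin 3)) :
    0 ≤ fderiv ℝ (fun y : EuclideanSpace ℝ (Fin 3) => (2 * Real.pi)⁻¹ * circ v (cylRadius y) (y 2) s) x (eR x) := by
  rw [fderiv_circF_eR hv hs]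
  exact mul_nonneg (by positivity) (vortCirc_nonneg v hsign hs (cylRadius_nonneg x) _)

/-- **The Laplacian of `F` off the axis** is the cylindrical Laplacian of `Γ`:
`ΔF(s,·)(x) = (2π)⁻¹ (Γ_rr + r⁻¹Γ_r + Γ_zz)`. -/
theorem laplacian_circF (hv : IsSmoothSpaceTimeOn (Iio (0 : ℝ)) v) {s : ℝ} (hs : s < 0) {x : EuclideanSpace ℝ (Fin 3)}
    (hx : cylRadius x ≠ 0) :
    (Δ (fun y : EuclideanSpace ℝ (Fin 3) => (2 * Real.pi)⁻¹ * circ v (cylRadius y) (y 2) s)) x =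
      (2 * Real.pi)⁻¹ * (deriv (fun r' => deriv (fun r'' => circ v r'' (x 2) s) r') (cylRadius x)
        + (cylRadius x)⁻¹ * deriv (fun r' => circ v r' (x 2) s) (cylRadius x)
        + deriv (fun z' => deriv (fun z'' => circ v (cylRadius x) z'' s) z') (x 2)) := by
  have hΓ := contDiffOn_circ hv
  have hfun : (fun y : EuclideanSpace ℝ (Fin 3) => (2 * Real.pi)⁻¹ * circ v (cylRadius y) (y 2) s) =
      (2 * Real.pi)⁻¹ • lift (circ v) s := by
    funext y; rfl
  have h2 : ContDiffAt ℝ 2 (lift (circ v) s) x := contDiffAt_lift hΓ hs hx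
  rw [hfun, InnerProductSpace.laplacian_smul _ h2, smul_eq_mul, laplacian_lift hΓ hs hx]

/-- **The time derivative of `F` off the axis** exists and is `(2π)⁻¹ ∂ₛΓ`. -/
theorem hasDerivAt_circF_time (hv : IsSmoothSpaceTimeOn (Iio (0 : ℝ)) v) {s : ℝ} (hs : s < 0) (x : EuclideanSpace ℝ (Fin 3)) :
    HasDerivAt (fun s' => (2 * Real.pi)⁻¹ * circ v (cylRadius x) (x 2) s')
      ((2 * Real.pi)⁻¹ * deriv (fun s' => circ v (cylRadius x) (x 2) s') s) s := by
  have h := Summit.NavierStokesRegularity.NavierStokesRegularity.Theorems.AveragedConeLiouville.CircleSwirl.hasDerivAt_circ_s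
    isOpen_Iio hv hs (cylRadius x) (x 2)
  rw [h.deriv]
  exact h.const_mul _

end Summit.NavierStokesRegularity.NavierStokesRegularity.Theorems.HalfSpaceWindowDoorCirculationCarryingRigidityAxisCirculation

end
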